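import Literature.MathematicalPhysics.QuantumLattice.FermiRG.FST3Main
import Mathlib.Analysis.Calculus.FDeriv.Add
import Mathlib.Analysis.Calculus.ContDiff.Operations
import HarnessLib

/-!
# FST III §1 norms `|·|_k`, `|·|_{k,h}`: linear algebra of the typed norm predicates (API, PROOFS)

J. Feldman, M. Salmhofer, E. Trubowitz, *Regularity of interacting nonspherical Fermi surfaces: the full
self-energy*, CPAM **52** (1999) 273–324 = arXiv:cond-mat/9705272 [FeldmanSalmhoferTrubowitz1999], §1
(1.1)–(1.2): "`|f|_k = sup_p Σ_{|α|≤k} |D^α f(p)|`", "`C^{k,h}` … with norm `|f|_{k,h}`"; and FST IV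
[FeldmanSalmhoferTrubowitz2000] §2.2 (p.7:L143–149) "`|F|_k = Σ_{l=0}^k ‖F‖_l` … With the norm
`|f|_k = Σ_{|α|≤k} ‖D^α f‖_∞`, it is a Banach space" (§1.2 p.4:L27–28).  The typed predicates
`FST3.CkHolderNormLE k h f N` ("`|f|_{k,h} ≤ N`") and `FST3.IsCkHolder` of `FermiRG/FST3Main.lean`
(frozen statement file, untouched) are built on the coordinate iterated partials `FST3.multiPartial α f`
(junk `0` off differentiability).  This file supplies the elementary LINEAR structure those norms have in
print (a normed vector space): `D^α` is additive / homogeneous on `C^{|α|}` functions, and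
`|f + g|_{k,h} ≤ |f|_{k,h} + |g|_{k,h}`, `|−f|_{k,h} = |f|_{k,h}`, `|c f|_{k,h} ≤ |c| |f|_{k,h}`,
`|f − g|_{k,h} ≤ |f|_{k,h} + |g|_{k,h}` — the triangle inequality / homogeneity used silently throughout
FST III–IV (e.g. FST IV §1.4 "`|K^{(R)}(e,λV)|₂ ≤ Σ_r |λ|^r κ_r`", p.5:L5–8; "`𝓔` is open in `|·|₂`",
p.4:L52).  All under `ContDiff ℝ k` where the junk values of `fderiv` would otherwise interfere
(negation is unconditional).  Theorems only; no definition, no `sorry`, net fact debt 0.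
-/

noncomputable section

open scoped BigOperators

namespace Literature.MathematicalPhysics.QuantumLattice.FermiRG

namespace FST3

variable {n : ℕ} {F : Type*} [NormedAddCommGroup F] [NormedSpace ℝ F]

/-! ### Regularity of the iterated coordinate partials -/

/-- `iterPartial (i :: l) f = ∂_i (iterPartial l f)` (definitional). [cite: FeldmanSalmhoferTrubowitz1999, §1 (1.1) p.1] -/
theorem iterPartial_cons (i : Fin n) (l : List (Fin n)) (f : Mom n → F) :
    iterPartial (i :: l) f = partialD i (iterPartial l f) := rfl

/-- `iterPartial [] f = f`. [cite: FeldmanSalmhoferTrubowitz1999, §1 (1.1) p.1] -/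
theorem iterPartial_nil (f : Mom n → F) : iterPartial [] f = f := rfl

/-- A `C^{m+1}` function has `C^m` coordinate partials. [cite: FeldmanSalmhoferTrubowitz1999, §1 (1.1) p.1] -/
theorem contDiff_partialD {m : ℕ} {f : Mom n → F} (hf : ContDiff ℝ (m + 1) f) (i : Fin n) :
    ContDiff ℝ m (partialD i f) := by
  unfold partialD
  have h : ContDiff ℝ m (fderiv ℝ f) := hf.fderiv_right (by norm_cast)
  exact h.clm_apply contDiff_const

/-- A `C^k` function has `C^m` iterated partials `iterPartial l` whenever `m + |l| ≤ k`.
[cite: FeldmanSalmhoferTrubowitz1999, §1 (1.1) p.1] -/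
theorem contDiff_iterPartial {k m : ℕ} (l : List (Fin n)) {f : Mom n → F} (hf : ContDiff ℝ k f)
    (hl : m + l.length ≤ k) : ContDiff ℝ m (iterPartial l f) := by
  induction l generalizing m with
  | nil =>
    rw [iterPartial_nil]
    exact hf.of_le (by exact_mod_cast (by simpa using hl : m ≤ k))
  | cons i l ih =>
    rw [iterPartial_cons]
    have h1 : (m + 1) + l.length ≤ k := by simp only [List.length_cons] at hl; omega
    have h2 : ContDiff ℝ (m + 1) (iterPartial l f) := by exact_mod_cast ih h1
    exact contDiff_partialD h2 i

/-- The canonical coordinate list of a multi-index `α` has length `|α|`.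
[cite: FeldmanSalmhoferTrubowitz1999, §1 (1.1) p.1] -/
theorem length_multiIndexList (α : Fin n → ℕ) :
    ((List.finRange n).flatMap fun i => List.replicate (α i) i).length = miOrder α := by
  rw [List.length_flatMap, miOrder, Fin.sum_univ_def]
  congr 1
  simp

/-- A `C^k` function has `C^m` partials `D^α` whenever `m + |α| ≤ k`. [cite: FeldmanSalmhoferTrubowitz1999, §1 (1.1) p.1] -/
theorem contDiff_multiPartial {k m : ℕ} (α : Fin n → ℕ) {f : Mom n → F} (hf : ContDiff ℝ k f)
    (hα : m + miOrder α ≤ k) : ContDiff ℝ m (multiPartial α f) := by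
  unfold multiPartial
  exact contDiff_iterPartial _ hf (by rwa [length_multiIndexList])

/-! ### Additivity and homogeneity of `∂_i`, `iterPartial`, `D^α` -/

/-- `∂_i (u + v) = ∂_i u + ∂_i v` for differentiable `u, v`. [cite: FeldmanSalmhoferTrubowitz1999, §1 (1.1) p.1] -/
theorem partialD_add {u v : Mom n → F} (hu : Differentiable ℝ u) (hv : Differentiable ℝ v)
    (i : Fin n) : partialD i (u + v) = partialD i u + partialD i v := by
  funext p
  simp only [partialD, Pi.add_apply, fderiv_add (hu p) (hv p), add_apply]

/-- `∂_i (−u) = −∂_i u` (unconditionally). [cite: FeldmanSalmhoferTrubowitz1999, §1 (1.1) p.1] -/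
theorem partialD_neg (u : Mom n → F) (i : Fin n) : partialD i (-u) = -partialD i u := by
  funext p
  simp only [partialD, Pi.neg_apply, fderiv_neg, neg_apply]

/-- `∂_i (c u) = c ∂_i u` for differentiable `u`. [cite: FeldmanSalmhoferTrubowitz1999, §1 (1.1) p.1] -/
theorem partialD_smul {u : Mom n → F} (hu : Differentiable ℝ u) (c : ℝ) (i : Fin n) :
    partialD i (c • u) = c • partialD i u := by
  funext p
  simp only [partialD, Pi.smul_apply, fderiv_const_smul (hu p) c, smul_apply]

/-- `iterPartial l (u + v) = iterPartial l u + iterPartial l v` on `C^k` functions, `|l| ≤ k`.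
[cite: FeldmanSalmhoferTrubowitz1999, §1 (1.1) p.1] -/
theorem iterPartial_add {k : ℕ} (l : List (Fin n)) {u v : Mom n → F} (hu : ContDiff ℝ k u)
    (hv : ContDiff ℝ k v) (hl : l.length ≤ k) :
    iterPartial l (u + v) = iterPartial l u + iterPartial l v := by
  induction l with
  | nil => rfl
  | cons i l ih =>
    have hl' : l.length ≤ k := by simp only [List.length_cons] at hl; omega
    have h1 : 1 + l.length ≤ k := by simp only [List.length_cons] at hl; omega
    have hdu : Differentiable ℝ (iterPartial l u) :=
      (contDiff_iterPartial l hu h1).differentiable (by simp)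
    have hdv : Differentiable ℝ (iterPartial l v) :=
      (contDiff_iterPartial l hv h1).differentiable (by simp)
    rw [iterPartial_cons, iterPartial_cons, iterPartial_cons, ih hl', partialD_add hdu hdv]

/-- `iterPartial l (−u) = −iterPartial l u`. [cite: FeldmanSalmhoferTrubowitz1999, §1 (1.1) p.1] -/
theorem iterPartial_neg (l : List (Fin n)) (u : Mom n → F) : iterPartial l (-u) = -iterPartial l u := by
  induction l with
  | nil => rfl
  | cons i l ih => rw [iterPartial_cons, iterPartial_cons, ih, partialD_neg]

/-- `iterPartial l (c u) = c · iterPartial l u` on `C^k` functions, `|l| ≤ k`.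
[cite: FeldmanSalmhoferTrubowitz1999, §1 (1.1) p.1] -/
theorem iterPartial_smul {k : ℕ} (l : List (Fin n)) {u : Mom n → F} (hu : ContDiff ℝ k u)
    (hl : l.length ≤ k) (c : ℝ) : iterPartial l (c • u) = c • iterPartial l u := by
  induction l with
  | nil => rfl
  | cons i l ih =>
    have hl' : l.length ≤ k := by simp only [List.length_cons] at hl; omega
    have h1 : 1 + l.length ≤ k := by simp only [List.length_cons] at hl; omega
    have hdu : Differentiable ℝ (iterPartial l u) :=
      (contDiff_iterPartial l hu h1).differentiable (by simp)
    rw [iterPartial_cons, iterPartial_cons, ih hl', partialD_smul hdu]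

/-- `D^α (u + v) = D^α u + D^α v` on `C^k` functions, `|α| ≤ k`. [cite: FeldmanSalmhoferTrubowitz1999, §1 (1.1) p.1] -/
theorem multiPartial_add {k : ℕ} (α : Fin n → ℕ) {u v : Mom n → F} (hu : ContDiff ℝ k u)
    (hv : ContDiff ℝ k v) (hα : miOrder α ≤ k) :
    multiPartial α (u + v) = multiPartial α u + multiPartial α v := by
  unfold multiPartial
  exact iterPartial_add _ hu hv (by rwa [length_multiIndexList])

/-- `D^α (−u) = −D^α u`. [cite: FeldmanSalmhoferTrubowitz1999, §1 (1.1) p.1] -/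
theorem multiPartial_neg (α : Fin n → ℕ) (u : Mom n → F) : multiPartial α (-u) = -multiPartial α u :=
  iterPartial_neg _ u

/-- `D^α (c u) = c D^α u` on `C^k` functions, `|α| ≤ k`. [cite: FeldmanSalmhoferTrubowitz1999, §1 (1.1) p.1] -/
theorem multiPartial_smul {k : ℕ} (α : Fin n → ℕ) {u : Mom n → F} (hu : ContDiff ℝ k u)
    (hα : miOrder α ≤ k) (c : ℝ) : multiPartial α (c • u) = c • multiPartial α u := by
  unfold multiPartial
  exact iterPartial_smul _ hu (by rwa [length_multiIndexList]) c

/-- `D^α (u − v) = D^α u − D^α v` on `C^k` functions, `|α| ≤ k`. [cite: FeldmanSalmhoferTrubowitz1999, §1 (1.1) p.1] -/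
theorem multiPartial_sub {k : ℕ} (α : Fin n → ℕ) {u v : Mom n → F} (hu : ContDiff ℝ k u)
    (hv : ContDiff ℝ k v) (hα : miOrder α ≤ k) :
    multiPartial α (u - v) = multiPartial α u - multiPartial α v := by
  have hv' : ContDiff ℝ k (-v) := hv.neg
  rw [sub_eq_add_neg, multiPartial_add α hu hv' hα, multiPartial_neg, ← sub_eq_add_neg]

/-! ### The norm predicates: triangle inequality, symmetry, homogeneity -/

/-- **`|u + v|_{k,h} ≤ |u|_{k,h} + |v|_{k,h}`** (the norm of (1.1)/(1.2) is subadditive), for `C^k`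
functions. [cite: FeldmanSalmhoferTrubowitz1999, §1 (1.1)-(1.2) p.1] -/
theorem CkHolderNormLE.add {k : ℕ} {h : ℝ} {u v : Mom n → F} {N M : ℝ}
    (hu : CkHolderNormLE k h u N) (hv : CkHolderNormLE k h v M) (hcu : ContDiff ℝ k u)
    (hcv : ContDiff ℝ k v) : CkHolderNormLE k h (u + v) (N + M) := by
  obtain ⟨Bu, Hu, hBu, hHu, hHolu, hsumu⟩ := hu
  obtain ⟨Bv, Hv, hBv, hHv, hHolv, hsumv⟩ := hv
  have hD : ∀ α, miOrder α ≤ k → multiPartial α (u + v) = multiPartial α u + multiPartial α v :=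
    fun α hα => multiPartial_add α hcu hcv hα
  refine ⟨fun α => Bu α + Bv α, Hu + Hv, ?_, add_nonneg hHu hHv, ?_, ?_⟩
  · intro α hα p
    rw [hD α hα, Pi.add_apply]
    exact (norm_add_le _ _).trans (add_le_add (hBu α hα p) (hBv α hα p))
  · intro hh α hα x y
    rw [hD α hα.le]
    simp only [Pi.add_apply]
    calc ‖multiPartial α u x + multiPartial α v x - (multiPartial α u y + multiPartial α v y)‖
        = ‖(multiPartial α u x - multiPartial α u y) + (multiPartial α v x - multiPartial α v y)‖ := by
          congr 1; abel
      _ ≤ Hu * ‖x - y‖ ^ h + Hv * ‖x - y‖ ^ h :=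
          (norm_add_le _ _).trans (add_le_add (hHolu hh α hα x y) (hHolv hh α hα x y))
      _ = (Hu + Hv) * ‖x - y‖ ^ h := by ring
  · rw [Finset.sum_add_distrib]
    linarith

/-- **`|−u|_{k,h} ≤ N` iff-direction: `|u|_{k,h} ≤ N ⇒ |−u|_{k,h} ≤ N`** (unconditional).
[cite: FeldmanSalmhoferTrubowitz1999, §1 (1.1)-(1.2) p.1] -/
theorem CkHolderNormLE.neg {k : ℕ} {h : ℝ} {u : Mom n → F} {N : ℝ} (hu : CkHolderNormLE k h u N) :
    CkHolderNormLE k h (-u) N := by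
  obtain ⟨B, H, hB, hH, hHol, hsum⟩ := hu
  refine ⟨B, H, ?_, hH, ?_, hsum⟩
  · intro α hα p
    rw [multiPartial_neg, Pi.neg_apply, norm_neg]
    exact hB α hα p
  · intro hh α hα x y
    rw [multiPartial_neg]
    simp only [Pi.neg_apply]
    rw [← norm_neg]
    have : -(-multiPartial α u x - -multiPartial α u y) = multiPartial α u x - multiPartial α u y := by
      abel
    rw [this]
    exact hHol hh α hα x y

/-- **`|c u|_{k,h} ≤ |c| |u|_{k,h}`**, for `C^k` functions. [cite: FeldmanSalmhoferTrubowitz1999, §1 (1.1)-(1.2) p.1] -/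
theorem CkHolderNormLE.smul {k : ℕ} {h : ℝ} {u : Mom n → F} {N : ℝ} (hu : CkHolderNormLE k h u N)
    (hcu : ContDiff ℝ k u) (c : ℝ) : CkHolderNormLE k h (c • u) (|c| * N) := by
  obtain ⟨B, H, hB, hH, hHol, hsum⟩ := hu
  have hD : ∀ α, miOrder α ≤ k → multiPartial α (c • u) = c • multiPartial α u :=
    fun α hα => multiPartial_smul α hcu hα c
  have hB0 : ∀ α, miOrder α ≤ k → 0 ≤ B α := fun α hα => (norm_nonneg _).trans (hB α hα 0)
  refine ⟨fun α => if miOrder α ≤ k then |c| * B α else 0, |c| * H, ?_, mul_nonneg (abs_nonneg c) hH,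
    ?_, ?_⟩
  · intro α hα p
    dsimp only
    rw [if_pos hα, hD α hα, Pi.smul_apply, norm_smul, Real.norm_eq_abs]
    exact mul_le_mul_of_nonneg_left (hB α hα p) (abs_nonneg c)
  · intro hh α hα x y
    rw [hD α hα.le]
    simp only [Pi.smul_apply]
    rw [← smul_sub, norm_smul, Real.norm_eq_abs, mul_assoc]
    exact mul_le_mul_of_nonneg_left (hHol hh α hα x y) (abs_nonneg c)
  · have hmem : ∀ α ∈ multiIndicesLE n k, miOrder α ≤ k := by
      intro α hα
      simp only [multiIndicesLE, Finset.mem_filter] at hα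
      exact hα.2
    calc (∑ α ∈ multiIndicesLE n k, if miOrder α ≤ k then |c| * B α else 0) + |c| * H
        = (∑ α ∈ multiIndicesLE n k, |c| * B α) + |c| * H := by
          congr 1
          exact Finset.sum_congr rfl fun α hα => if_pos (hmem α hα)
      _ = |c| * ((∑ α ∈ multiIndicesLE n k, B α) + H) := by rw [← Finset.mul_sum]; ring
      _ ≤ |c| * N := mul_le_mul_of_nonneg_left hsum (abs_nonneg c)

/-- **`|u − v|_{k,h} ≤ |u|_{k,h} + |v|_{k,h}`**, for `C^k` functions.
[cite: FeldmanSalmhoferTrubowitz1999, §1 (1.1)-(1.2) p.1] -/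
theorem CkHolderNormLE.sub {k : ℕ} {h : ℝ} {u v : Mom n → F} {N M : ℝ}
    (hu : CkHolderNormLE k h u N) (hv : CkHolderNormLE k h v M) (hcu : ContDiff ℝ k u)
    (hcv : ContDiff ℝ k v) : CkHolderNormLE k h (u - v) (N + M) := by
  have hcv' : ContDiff ℝ k (-v) := hcv.neg
  rw [sub_eq_add_neg]
  exact hu.add hv.neg hcu hcv'

/-- `0 ≤ N` whenever `|u|_{k,h} ≤ N` (the bounds are nonnegative). [cite: FeldmanSalmhoferTrubowitz1999, §1 (1.1)-(1.2) p.1] -/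
theorem CkHolderNormLE.nonneg {k : ℕ} {h : ℝ} {u : Mom n → F} {N : ℝ} (hu : CkHolderNormLE k h u N) :
    0 ≤ N := by
  obtain ⟨B, H, hB, hH, -, hsum⟩ := hu
  have hB0 : ∀ α ∈ multiIndicesLE n k, 0 ≤ B α := by
    intro α hα
    simp only [multiIndicesLE, Finset.mem_filter] at hα
    exact (norm_nonneg _).trans (hB α hα.2 0)
  exact (add_nonneg (Finset.sum_nonneg hB0) hH).trans hsum

/-- The `C^{k,h}` class is closed under addition. [cite: FeldmanSalmhoferTrubowitz1999, §1 (1.2) p.1] -/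
theorem IsCkHolder.add {k : ℕ} {h : ℝ} {u v : Mom n → F} (hu : IsCkHolder k h u) (hv : IsCkHolder k h v) :
    IsCkHolder k h (u + v) := by
  obtain ⟨hcu, N, hN⟩ := hu
  obtain ⟨hcv, M, hM⟩ := hv
  exact ⟨hcu.add hcv, N + M, hN.add hM hcu hcv⟩

/-- The `C^{k,h}` class is closed under negation. [cite: FeldmanSalmhoferTrubowitz1999, §1 (1.2) p.1] -/
theorem IsCkHolder.neg {k : ℕ} {h : ℝ} {u : Mom n → F} (hu : IsCkHolder k h u) : IsCkHolder k h (-u) := by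
  obtain ⟨hcu, N, hN⟩ := hu
  exact ⟨hcu.neg, N, hN.neg⟩

/-- The `C^{k,h}` class is closed under scalar multiplication. [cite: FeldmanSalmhoferTrubowitz1999, §1 (1.2) p.1] -/
theorem IsCkHolder.smul {k : ℕ} {h : ℝ} {u : Mom n → F} (hu : IsCkHolder k h u) (c : ℝ) :
    IsCkHolder k h (c • u) := by
  obtain ⟨hcu, N, hN⟩ := hu
  exact ⟨hcu.const_smul c, |c| * N, hN.smul hcu c⟩

/-! ### Accessors: the zero multi-index and the sup-norm bound `‖f‖_∞ ≤ |f|_{k,h}` -/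

/-- `D^0 f = f` (the empty list of partials). [cite: FeldmanSalmhoferTrubowitz1999, §1 (1.1) p.1] -/
theorem multiPartial_zero_index (f : Mom n → F) : multiPartial (fun _ : Fin n => 0) f = f := by
  have h : ((List.finRange n).flatMap fun i : Fin n => List.replicate ((fun _ : Fin n => 0) i) i) = [] := by
    simp
  rw [multiPartial, h, iterPartial_nil]

/-- The zero multi-index belongs to `{α : |α| ≤ k}`. [cite: FeldmanSalmhoferTrubowitz1999, §1 (1.1) p.1] -/
theorem zero_mem_multiIndicesLE (n k : ℕ) : (fun _ : Fin n => 0) ∈ multiIndicesLE n k := by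
  simp only [multiIndicesLE, Finset.mem_filter, Finset.mem_image, Finset.mem_univ, true_and]
  exact ⟨⟨fun _ => 0, funext fun _ => rfl⟩, by simp [miOrder]⟩

/-- **`‖f‖_∞ ≤ |f|_{k,h}`**: a bound `|f|_{k,h} ≤ N` bounds `f` itself (the `α = 0` term of (1.1)).
[cite: FeldmanSalmhoferTrubowitz1999, §1 (1.1) p.1] -/
theorem CkHolderNormLE.norm_le {k : ℕ} {h : ℝ} {u : Mom n → F} {N : ℝ} (hu : CkHolderNormLE k h u N)
    (x : Mom n) : ‖u x‖ ≤ N := by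
  obtain ⟨B, H, hB, hH, -, hsum⟩ := hu
  have hB0 : ∀ α ∈ multiIndicesLE n k, 0 ≤ B α := by
    intro α hα
    simp only [multiIndicesLE, Finset.mem_filter] at hα
    exact (norm_nonneg _).trans (hB α hα.2 0)
  have h0 : ‖u x‖ ≤ B (fun _ => 0) := by
    have := hB (fun _ => 0) (by simp [miOrder]) x
    rwa [multiPartial_zero_index] at this
  calc ‖u x‖ ≤ B (fun _ => 0) := h0
    _ ≤ ∑ α ∈ multiIndicesLE n k, B α :=
        Finset.single_le_sum hB0 (zero_mem_multiIndicesLE n k)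
    _ ≤ N := by linarith

end FST3

end Literature.MathematicalPhysics.QuantumLattice.FermiRG
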